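import Summits.QuantumAdvantage.QuantumAdvantage.Theorems.MobiusLadderDigitPolyUniformityWalshGappedLemmas

/-!
# Prime dilates of gap-separated Walsh characters decorrelate, II: the Riesz product along the
# doubling map and the dilate correlation (stub `stub_walshGapped` of line `Sketch`, crux
# `DigitPolyUniformity`, stmt-QuantumAdvantage-1392)

With `φ_i(x) = (−1)^{⌊p(x mod 2^i)/2^i⌋ + ⌊q(x mod 2^i)/2^i⌋}` (the carry-sign of Part I,
`MobiusLadderDigitPolyUniformityWalshGappedLemmas.lean`):

* `abs_sum_range_prod_sub_le` — for a finite set `S` of positions, all `≥ G` and pairwise `≥ G`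
  apart, `|Σ_{x<2^L} Π_{i∈S} φ_i(x) − 2^L (pq)^{−#S}| ≤ 2^L·#S·2(p+q)/2^G` (induction on the top
  position: below it the product is periodic, and summing the top factor over the `G` digits under
  it is a shifted coarse Riemann sum of `σ`, Part I `abs_coarseSum_sub_le`);
* `stub_walshGapped` — `|Σ_{1≤x≤M} w_S(px) w_S(qx) − M/(pq)^{#S}| ≤ (M+1)·#S·2(p+q)/2^G + 2^{L+1}`
  for the genuine digit signs `w_S(y) = Π_{i∈S}(−1)^{bit_i(y)}`, odd coprime `p, q`, `L` above
  every position of `S`: the degree-one, gap-separated case of the transfer stub (registered support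
  stub of the skeleton `Cruxes/DigitPolyUniformity/Lines/Sketch.lean`).

All elementary; no named facts.
-/

open Finset

namespace Summit.QuantumAdvantage.DigitPolyUniformity.Sketch

/-! ### The product over a gap-separated set of digit positions -/

/-- `|(−1)^k| = 1`-type bound for the carry-sign products: `|Π_{i∈S} (−1)^{e_i}| ≤ 1`. [folklore] -/
theorem abs_prod_neg_one_pow_le_one (S : Finset ℕ) (e : ℕ → ℕ) :
    |∏ i ∈ S, (-1 : ℝ) ^ (e i)| ≤ 1 := by
  rw [Finset.abs_prod]
  apply le_of_eq
  refine Finset.prod_eq_one fun i _ => ?_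
  rw [abs_pow, abs_neg, abs_one, one_pow]

/-- The carry-sign product only depends on `x mod 2^L` once every position is `≤ L`:
`Π_{i∈S} φ_i(2^L y + r) = Π_{i∈S} φ_i(r)`. [folklore] -/
theorem prod_carrySign_add_mul {p q : ℕ} (S : Finset ℕ) {L : ℕ} (hL : ∀ i ∈ S, i ≤ L) (y r : ℕ) :
    ∏ i ∈ S, (-1 : ℝ) ^ (p * ((2 ^ L * y + r) % 2 ^ i) / 2 ^ i + q * ((2 ^ L * y + r) % 2 ^ i) / 2 ^ i)
      = ∏ i ∈ S, (-1 : ℝ) ^ (p * (r % 2 ^ i) / 2 ^ i + q * (r % 2 ^ i) / 2 ^ i) := by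
  refine Finset.prod_congr rfl fun i hi => ?_
  have hmod : (2 ^ L * y + r) % 2 ^ i = r % 2 ^ i := by
    obtain ⟨d, hd⟩ := Nat.exists_eq_add_of_le (hL i hi)
    rw [hd, pow_add, show 2 ^ i * 2 ^ d * y + r = r + 2 ^ i * (2 ^ d * y) by ring,
      Nat.add_mul_mod_self_left]
  rw [hmod]

/-- **The gap-separated Riesz product.** For odd coprime `p, q` and a finite set `S` of digit
positions, all `≥ G` and pairwise `≥ G` apart, and `L` above every position:
`|Σ_{x<2^L} Π_{i∈S} (−1)^{⌊p(x mod 2^i)/2^i⌋+⌊q(x mod 2^i)/2^i⌋} − 2^L/(pq)^{#S}| ≤ 2^L·#S·2(p+q)/2^G`.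
Induction on the largest position `i = s + G`: below it the product is `2^s`-periodic, and summing the
top factor over the `G` digits in `[s, s+G)` is a shifted coarse Riemann sum of `σ`
(Part I `abs_coarseSum_sub_le`). [folklore] -/
theorem abs_sum_range_prod_sub_le {p q : ℕ} (hp : Odd p) (hq : Odd q) (hpq : p.Coprime q)
    (G : ℕ) (S : Finset ℕ) (hSG : ∀ i ∈ S, G ≤ i)
    (hgap : ∀ i ∈ S, ∀ i' ∈ S, i < i' → i + G ≤ i') (L : ℕ) (hL : ∀ i ∈ S, i ≤ L) :
    |∑ x ∈ range (2 ^ L),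
        ∏ i ∈ S, (-1 : ℝ) ^ (p * (x % 2 ^ i) / 2 ^ i + q * (x % 2 ^ i) / 2 ^ i)
      - 2 ^ L / ((p : ℝ) * q) ^ S.card| ≤ 2 ^ L * S.card * (2 * (p + q)) / 2 ^ G := by
  have hp0 : (0 : ℝ) < p := by exact_mod_cast hp.pos
  have hq0 : (0 : ℝ) < q := by exact_mod_cast hq.pos
  have hpq1 : (1 : ℝ) ≤ (p : ℝ) * q := by
    have h1 : (1 : ℝ) ≤ p := by exact_mod_cast hp.pos
    have h2 : (1 : ℝ) ≤ q := by exact_mod_cast hq.pos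
    nlinarith
  -- induction on `S` through its maximum, for all `L`
  induction S using Finset.induction_on_max generalizing L with
  | empty =>
    simp
  | insert i S' hlt ih =>
    have hi_notin : i ∉ S' := fun h => lt_irrefl i (hlt i h)
    have hGi : G ≤ i := hSG i (Finset.mem_insert_self i S')
    obtain ⟨s, hs⟩ : ∃ s, i = s + G := ⟨i - G, by omega⟩
    have hS'G : ∀ i' ∈ S', G ≤ i' := fun i' hi' => hSG i' (Finset.mem_insert_of_mem hi')
    have hS'gap : ∀ a ∈ S', ∀ b ∈ S', a < b → a + G ≤ b := fun a ha b hb hab =>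
      hgap a (Finset.mem_insert_of_mem ha) b (Finset.mem_insert_of_mem hb) hab
    have hS's : ∀ i' ∈ S', i' ≤ s := by
      intro i' hi'
      have := hgap i' (Finset.mem_insert_of_mem hi') i (Finset.mem_insert_self i S') (hlt i' hi')
      omega
    have hiL : i ≤ L := hL i (Finset.mem_insert_self i S')
    have hcard : (insert i S').card = S'.card + 1 := Finset.card_insert_of_notMem hi_notin
    -- Step 1: reduce the range `2^L` to `2^i` by periodicity.
    set P : ℕ → ℝ := fun x => ∏ i' ∈ insert i S', (-1 : ℝ) ^
      (p * (x % 2 ^ i') / 2 ^ i' + q * (x % 2 ^ i') / 2 ^ i') with hPdef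
    have hins : ∀ i' ∈ insert i S', i' ≤ i := by
      intro i' hi'
      rcases Finset.mem_insert.mp hi' with rfl | h
      · exact le_rfl
      · exact (hlt i' h).le
    have hper : ∑ x ∈ range (2 ^ L), P x = 2 ^ (L - i) * ∑ x ∈ range (2 ^ i), P x := by
      obtain ⟨d, hd⟩ := Nat.exists_eq_add_of_le hiL
      rw [hd, Nat.add_sub_cancel_left, pow_add, sum_range_mul_split]
      have : ∀ y ∈ range (2 ^ d), ∑ r ∈ range (2 ^ i), P (2 ^ i * y + r) = ∑ r ∈ range (2 ^ i), P r :=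
        fun y _ => Finset.sum_congr rfl fun r _ => prod_carrySign_add_mul _ hins y r
      rw [Finset.sum_congr rfl this, Finset.sum_const, Finset.card_range, nsmul_eq_mul]
      push_cast
      ring
    -- Step 2: split `x < 2^i = 2^s · 2^G` as `x = 2^s y + a`... we sum `a` inside: x = 2^s * y + a.
    set P' : ℕ → ℝ := fun x => ∏ i' ∈ S', (-1 : ℝ) ^
      (p * (x % 2 ^ i') / 2 ^ i' + q * (x % 2 ^ i') / 2 ^ i') with hP'def
    set C : ℕ → ℝ := fun a => ∑ y ∈ range (2 ^ G), (-1 : ℝ) ^ (p * (a + 2 ^ s * y) / 2 ^ (s + G) +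
        q * (a + 2 ^ s * y) / 2 ^ (s + G)) with hCdef
    have hsplit : ∑ x ∈ range (2 ^ i), P x = ∑ a ∈ range (2 ^ s), P' a * C a := by
      rw [hs, pow_add, sum_range_mul_split]
      -- ∑ y<2^G ∑ a<2^s P (2^s y + a) ; swap and identify
      rw [Finset.sum_comm]
      refine Finset.sum_congr rfl fun a ha => ?_
      rw [hCdef, Finset.mul_sum]
      refine Finset.sum_congr rfl fun y hy => ?_
      have ha' := Finset.mem_range.mp ha
      have hy' := Finset.mem_range.mp hy
      have hx : 2 ^ s * y + a < 2 ^ (s + G) := by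
        rw [pow_add]
        calc 2 ^ s * y + a < 2 ^ s * y + 2 ^ s := by omega
          _ = 2 ^ s * (y + 1) := by ring
          _ ≤ 2 ^ s * 2 ^ G := Nat.mul_le_mul_left _ hy'
      have hx' : 2 ^ s * y + a < 2 ^ i := by rw [hs]; exact hx
      rw [hPdef]
      simp only
      rw [Finset.prod_insert hi_notin, mul_comm (P' a)]
      congr 1
      · -- the top factor: `x % 2^i = x`
        rw [Nat.mod_eq_of_lt hx', show 2 ^ s * y + a = a + 2 ^ s * y from by ring, hs]
      · exact prod_carrySign_add_mul S' hS's y a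
    -- Step 3: the estimate.
    have hC : ∀ a ∈ range (2 ^ s), |C a - 2 ^ G / (p * q)| ≤ 2 * (p + q) :=
      fun a ha => abs_coarseSum_sub_le hp hq hpq s G a (Finset.mem_range.mp ha)
    have hIH := ih hS'G hS'gap s hS's
    have hP'1 : ∀ a, |P' a| ≤ 1 := fun a => abs_prod_neg_one_pow_le_one _ _
    -- main computation at level `2^i`
    have hmain : |∑ x ∈ range (2 ^ i), P x - 2 ^ i / ((p : ℝ) * q) ^ (S'.card + 1)| ≤
        2 ^ i * (S'.card + 1) * (2 * (p + q)) / 2 ^ G := by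
      rw [hsplit]
      have e1 : ∑ a ∈ range (2 ^ s), P' a * C a =
          2 ^ G / (p * q) * ∑ a ∈ range (2 ^ s), P' a +
            ∑ a ∈ range (2 ^ s), P' a * (C a - 2 ^ G / (p * q)) := by
        rw [Finset.mul_sum, ← Finset.sum_add_distrib]
        refine Finset.sum_congr rfl fun a _ => ?_
        ring
      have hrem : |∑ a ∈ range (2 ^ s), P' a * (C a - 2 ^ G / (p * q))| ≤ 2 ^ s * (2 * (p + q)) := by
        calc |∑ a ∈ range (2 ^ s), P' a * (C a - 2 ^ G / (p * q))|
            ≤ ∑ a ∈ range (2 ^ s), |P' a * (C a - 2 ^ G / (p * q))| := Finset.abs_sum_le_sum_abs _ _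
          _ ≤ ∑ a ∈ range (2 ^ s), (2 * ((p : ℝ) + q)) := by
              refine Finset.sum_le_sum fun a ha => ?_
              rw [abs_mul]
              calc |P' a| * |C a - 2 ^ G / (p * q)| ≤ 1 * (2 * (p + q)) :=
                    mul_le_mul (hP'1 a) (hC a ha) (abs_nonneg _) zero_le_one
                _ = 2 * (p + q) := one_mul _
          _ = 2 ^ s * (2 * (p + q)) := by
              rw [Finset.sum_const, Finset.card_range, nsmul_eq_mul]; push_cast; ring
      have hmt : (2 : ℝ) ^ i / ((p : ℝ) * q) ^ (S'.card + 1) =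
          2 ^ G / (p * q) * (2 ^ s / ((p : ℝ) * q) ^ S'.card) := by
        rw [hs, pow_add, pow_succ]
        field_simp
      rw [e1, hmt]
      have hA : |2 ^ G / ((p : ℝ) * q) * ∑ a ∈ range (2 ^ s), P' a -
          2 ^ G / (p * q) * (2 ^ s / ((p : ℝ) * q) ^ S'.card)| ≤ 2 ^ s * S'.card * (2 * (p + q)) := by
        rw [← mul_sub, abs_mul, abs_of_nonneg (by positivity)]
        calc 2 ^ G / ((p : ℝ) * q) * |∑ a ∈ range (2 ^ s), P' a - 2 ^ s / ((p : ℝ) * q) ^ S'.card|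
            ≤ 2 ^ G / ((p : ℝ) * q) * (2 ^ s * S'.card * (2 * (p + q)) / 2 ^ G) :=
              mul_le_mul_of_nonneg_left hIH (by positivity)
          _ = (2 ^ s * S'.card * (2 * (p + q))) / (p * q) := by
              field_simp
          _ ≤ 2 ^ s * S'.card * (2 * (p + q)) := div_le_self (by positivity) hpq1
      have h2i : (2 : ℝ) ^ i = 2 ^ s * 2 ^ G := by rw [hs, pow_add]
      calc |2 ^ G / ((p : ℝ) * q) * ∑ a ∈ range (2 ^ s), P' a +
              ∑ a ∈ range (2 ^ s), P' a * (C a - 2 ^ G / (p * q)) -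
              2 ^ G / (p * q) * (2 ^ s / ((p : ℝ) * q) ^ S'.card)|
          = |(2 ^ G / ((p : ℝ) * q) * ∑ a ∈ range (2 ^ s), P' a -
              2 ^ G / (p * q) * (2 ^ s / ((p : ℝ) * q) ^ S'.card)) +
              ∑ a ∈ range (2 ^ s), P' a * (C a - 2 ^ G / (p * q))| := by ring_nf
        _ ≤ 2 ^ s * S'.card * (2 * (p + q)) + 2 ^ s * (2 * (p + q)) :=
            (abs_add_le _ _).trans (add_le_add hA hrem)
        _ = 2 ^ i * (S'.card + 1) * (2 * (p + q)) / 2 ^ G := by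
            rw [h2i]; field_simp
    -- Step 4: back to level `2^L`.
    rw [hcard, hper]
    obtain ⟨d, hd⟩ := Nat.exists_eq_add_of_le hiL
    have h2L : (2 : ℝ) ^ L = 2 ^ d * 2 ^ i := by rw [hd, pow_add]; ring
    rw [hd, Nat.add_sub_cancel_left]
    push_cast
    calc |(2 : ℝ) ^ d * ∑ x ∈ range (2 ^ i), P x - 2 ^ (i + d) / ((p : ℝ) * q) ^ (S'.card + 1)|
        = 2 ^ d * |∑ x ∈ range (2 ^ i), P x - 2 ^ i / ((p : ℝ) * q) ^ (S'.card + 1)| := by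
          rw [← abs_of_pos (by positivity : (0 : ℝ) < 2 ^ d), ← abs_mul]
          congr 1
          rw [abs_of_pos (by positivity : (0 : ℝ) < 2 ^ d), pow_add]
          ring
      _ ≤ 2 ^ d * (2 ^ i * (S'.card + 1) * (2 * (p + q)) / 2 ^ G) :=
          mul_le_mul_of_nonneg_left hmain (by positivity)
      _ = 2 ^ (i + d) * ((S'.card : ℝ) + 1) * (2 * (p + q)) / 2 ^ G := by
          rw [pow_add]; ring

/-! ### The dilate correlation of a gap-separated Walsh character -/

/-- Pointwise: the product of the Walsh characters of the two dilates is the carry-sign product.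
[folklore] -/
theorem walsh_dilate_mul_eq_prod_carrySign {p q : ℕ} (hp : Odd p) (hq : Odd q) (S : Finset ℕ)
    (x : ℕ) :
    (∏ i ∈ S, (if Nat.testBit (p * x) i then (-1 : ℝ) else 1)) *
        (∏ i ∈ S, (if Nat.testBit (q * x) i then (-1 : ℝ) else 1)) =
      ∏ i ∈ S, (-1 : ℝ) ^ (p * (x % 2 ^ i) / 2 ^ i + q * (x % 2 ^ i) / 2 ^ i) := by
  rw [← Finset.prod_mul_distrib]
  refine Finset.prod_congr rfl fun i _ => ?_
  rw [ite_testBit_eq_neg_one_pow, ite_testBit_eq_neg_one_pow,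
    neg_one_pow_div_mul_neg_one_pow_div hp hq]

/-- **Prime dilates of gap-separated Walsh characters decorrelate.** For odd coprime `p, q`
(in particular distinct odd primes), a finite set `S` of binary digit positions that are all `≥ G`
and pairwise `≥ G` apart, `L` above every position, and every `M`:
`|Σ_{1≤x≤M} w_S(px) w_S(qx) − M/(pq)^{#S}| ≤ (M+1)·#S·2(p+q)/2^G + 2^{L+1}`,
where `w_S(y) = Π_{i∈S} (−1)^{bit_i(y)}`. With `G → ∞` slowly and `2^L = o(M)` this is the
degree-one, gap-separated case of the transfer stub of line `Sketch` (pair correlation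
`→ (pq)^{−#S} ≤ 1/(pq)`). [folklore] -/
theorem stub_walshGapped {p q : ℕ} (hp : Odd p) (hq : Odd q) (hpq : p.Coprime q)
    (G : ℕ) (S : Finset ℕ) (hSG : ∀ i ∈ S, G ≤ i)
    (hgap : ∀ i ∈ S, ∀ i' ∈ S, i < i' → i + G ≤ i') (L : ℕ) (hL : ∀ i ∈ S, i ≤ L) (M : ℕ) :
    |∑ x ∈ Icc 1 M, (∏ i ∈ S, (if Nat.testBit (p * x) i then (-1 : ℝ) else 1)) *
          (∏ i ∈ S, (if Nat.testBit (q * x) i then (-1 : ℝ) else 1))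
        - M / ((p : ℝ) * q) ^ S.card| ≤
      (M + 1) * S.card * (2 * (p + q)) / 2 ^ G + 2 ^ (L + 1) := by
  have hp0 : (0 : ℝ) < p := by exact_mod_cast hp.pos
  have hq0 : (0 : ℝ) < q := by exact_mod_cast hq.pos
  have hpq1 : (1 : ℝ) ≤ ((p : ℝ) * q) ^ S.card := by
    have h1 : (1 : ℝ) ≤ p := by exact_mod_cast hp.pos
    have h2 : (1 : ℝ) ≤ q := by exact_mod_cast hq.pos
    exact one_le_pow₀ (by nlinarith)
  set Φ : ℕ → ℝ := fun x => ∏ i ∈ S, (-1 : ℝ) ^ (p * (x % 2 ^ i) / 2 ^ i + q * (x % 2 ^ i) / 2 ^ i)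
    with hΦdef
  have hΦ1 : ∀ x, |Φ x| ≤ 1 := fun x => abs_prod_neg_one_pow_le_one _ _
  simp_rw [walsh_dilate_mul_eq_prod_carrySign hp hq S]
  change |∑ x ∈ Icc 1 M, Φ x - M / ((p : ℝ) * q) ^ S.card| ≤ _
  -- `Icc 1 M = range (M+1) ∖ {0}`
  have hIcc : ∑ x ∈ Icc 1 M, Φ x = ∑ x ∈ range (M + 1), Φ x - Φ 0 := by
    rw [Finset.range_eq_Ico, Finset.sum_eq_sum_Ico_succ_bot (Nat.succ_pos M)]
    have : Finset.Ico 1 (M + 1) = Icc 1 M := by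
      ext x; simp only [Finset.mem_Ico, Finset.mem_Icc]; omega
    rw [this]; ring
  -- split `M + 1 = 2^L c + r`
  set c := (M + 1) / 2 ^ L with hcdef
  set r := (M + 1) % 2 ^ L with hrdef
  have hMr : M + 1 = 2 ^ L * c + r := (Nat.div_add_mod (M + 1) (2 ^ L)).symm
  have hrlt : r < 2 ^ L := Nat.mod_lt _ (Nat.two_pow_pos L)
  set A := ∑ x ∈ range (2 ^ L), Φ x with hAdef
  have hA : |A - 2 ^ L / ((p : ℝ) * q) ^ S.card| ≤ 2 ^ L * S.card * (2 * (p + q)) / 2 ^ G :=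
    abs_sum_range_prod_sub_le hp hq hpq G S hSG hgap L hL
  have hrange : ∑ x ∈ range (M + 1), Φ x = c * A + ∑ x ∈ range r, Φ (2 ^ L * c + x) := by
    rw [hMr, Finset.sum_range_add, sum_range_mul_split]
    have : ∀ y ∈ range c, ∑ x ∈ range (2 ^ L), Φ (2 ^ L * y + x) = A :=
      fun y _ => Finset.sum_congr rfl fun x _ => prod_carrySign_add_mul S hL y x
    rw [Finset.sum_congr rfl this, Finset.sum_const, Finset.card_range, nsmul_eq_mul]
  have htail : |∑ x ∈ range r, Φ (2 ^ L * c + x)| ≤ r := by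
    calc |∑ x ∈ range r, Φ (2 ^ L * c + x)| ≤ ∑ x ∈ range r, |Φ (2 ^ L * c + x)| :=
          Finset.abs_sum_le_sum_abs _ _
      _ ≤ ∑ x ∈ range r, (1 : ℝ) := Finset.sum_le_sum fun x _ => hΦ1 _
      _ = r := by simp
  -- real-number bookkeeping
  have hMr' : (M : ℝ) + 1 = 2 ^ L * c + r := by exact_mod_cast hMr
  have hrr : (r : ℝ) < 2 ^ L := by exact_mod_cast hrlt
  have hc0 : (0 : ℝ) ≤ c := Nat.cast_nonneg c
  have hr0 : (0 : ℝ) ≤ r := Nat.cast_nonneg r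
  have h2L : (0 : ℝ) < 2 ^ L := by positivity
  have hcA : |(c : ℝ) * A - c * (2 ^ L / ((p : ℝ) * q) ^ S.card)| ≤
      (M + 1) * S.card * (2 * (p + q)) / 2 ^ G := by
    rw [← mul_sub, abs_mul, Nat.abs_cast]
    calc (c : ℝ) * |A - 2 ^ L / ((p : ℝ) * q) ^ S.card|
        ≤ c * (2 ^ L * S.card * (2 * (p + q)) / 2 ^ G) := mul_le_mul_of_nonneg_left hA hc0
      _ = (2 ^ L * c) * (S.card * (2 * (p + q)) / 2 ^ G) := by ring
      _ ≤ (M + 1) * (S.card * (2 * (p + q)) / 2 ^ G) := by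
          apply mul_le_mul_of_nonneg_right _ (by positivity)
          linarith
      _ = (M + 1) * S.card * (2 * (p + q)) / 2 ^ G := by ring
  have hmid : |(c : ℝ) * (2 ^ L / ((p : ℝ) * q) ^ S.card) - M / ((p : ℝ) * q) ^ S.card| ≤ 2 ^ L := by
    have e : (c : ℝ) * (2 ^ L / ((p : ℝ) * q) ^ S.card) - M / ((p : ℝ) * q) ^ S.card =
        (1 - r) / ((p : ℝ) * q) ^ S.card := by
      have : (c : ℝ) * 2 ^ L = M + 1 - r := by linarith
      field_simp
      linarith
    rw [e, abs_div, abs_of_pos (a := ((p : ℝ) * q) ^ S.card) (by positivity)]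
    calc |1 - (r : ℝ)| / ((p : ℝ) * q) ^ S.card ≤ |1 - (r : ℝ)| := div_le_self (abs_nonneg _) hpq1
      _ ≤ 2 ^ L := by
          rw [abs_le]; constructor <;> linarith [Nat.one_le_two_pow (n := L),
            show (1 : ℝ) ≤ 2 ^ L from by exact_mod_cast Nat.one_le_two_pow]
  rw [hIcc, hrange]
  have hΦ0 := hΦ1 0
  calc |(c : ℝ) * A + ∑ x ∈ range r, Φ (2 ^ L * c + x) - Φ 0 - M / ((p : ℝ) * q) ^ S.card|
      = |((c : ℝ) * A - c * (2 ^ L / ((p : ℝ) * q) ^ S.card)) +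
          ((c : ℝ) * (2 ^ L / ((p : ℝ) * q) ^ S.card) - M / ((p : ℝ) * q) ^ S.card) +
          (∑ x ∈ range r, Φ (2 ^ L * c + x) - Φ 0)| := by ring_nf
    _ ≤ |(c : ℝ) * A - c * (2 ^ L / ((p : ℝ) * q) ^ S.card)| +
          |(c : ℝ) * (2 ^ L / ((p : ℝ) * q) ^ S.card) - M / ((p : ℝ) * q) ^ S.card| +
          |∑ x ∈ range r, Φ (2 ^ L * c + x) - Φ 0| := abs_add_three _ _ _
    _ ≤ (M + 1) * S.card * (2 * (p + q)) / 2 ^ G + 2 ^ L + (r + 1) := by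
        refine add_le_add (add_le_add hcA hmid) ?_
        calc |∑ x ∈ range r, Φ (2 ^ L * c + x) - Φ 0|
            ≤ |∑ x ∈ range r, Φ (2 ^ L * c + x)| + |Φ 0| := abs_sub _ _
          _ ≤ r + 1 := add_le_add htail hΦ0
    _ ≤ (M + 1) * S.card * (2 * (p + q)) / 2 ^ G + 2 ^ (L + 1) := by
        rw [pow_succ]
        have : (r : ℝ) + 1 ≤ 2 ^ L := by
          have : r + 1 ≤ 2 ^ L := hrlt
          exact_mod_cast this
        linarith

end Summit.QuantumAdvantage.DigitPolyUniformity.Sketch
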